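import Summits.QuantumFields.YangMills.Theorems.FibreAnchor.Negative.DanglingLink
import Literature.MathematicalPhysics.QuantumLattice.GaugeGroupsProofs

/-!
# `FibreAnchor` — negative lemmas, part 3/3: three load-bearing clauses of the crux
# (crux stmt-QuantumFields-16243, route `ContractibleFibre`; cdisprove cycle 1)

The crux `Summit.QuantumFields.YangMills.Theses.ContractibleFibre.FibreAnchor` asks, on the free
tubes `(ℤ/L)² × Fin(M+1)²`, for `|E[F₁·F₂∘σ_n] − E[F₁]E[F₂∘σ_n]| ≤ C e^{−m₀ n}` for all bounded
(`|F| ≤ 1`) measurable `[c, c+w]`-time-slab observables, all `2n < L`, with `∀ w ∃ C ∃ Lmin`.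
Each of these three guards is NECESSARY — the crux with exactly one of them relaxed is FALSE,
unconditionally (instance `G = SU(2)`, fundamental `r`, certified by the tree's
`isSimpleCompactGroup_specialUnitaryGroup_holds`):

* `fibreAnchor_false_without_halfTimeGuard` — guard `2 * n < L` weakened to `n < L`;
* `fibreAnchor_false_with_widthUniformConstant` — `∃ C, ∀ w, ∃ Lmin` for `∀ w, ∃ C, ∃ Lmin`;
* `fibreAnchor_false_without_observableBound` — the conjunct `∀ U, |F U| ≤ 1` dropped.

All three rest on part 2's variance floor for a dangling-link indicator, proved for every
compact group with a faithful representation and an element `a ≠ 1` (`clause_fullCircle_false`: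
wrap-around `n = L − 1`; `clause_uniformW_false`: overlap `n = w`; `clauseU_false`: `n = 1`
scaled by `s`). The variant statements are the crux VERBATIM with one token changed, consumed
by definitional transport (the crux's `let` chain IS part 1's vocabulary).
-/

set_option autoImplicit false

noncomputable section

open MeasureTheory
open Literature.MathematicalPhysics.QuantumFieldTheory
open Summit.QuantumFields.YangMills.Theses.ContractibleFibre
open Summit.QuantumFields.YangMills.Theorems.FibreAnchor.Negative.TubeVocabulary
open Summit.QuantumFields.YangMills.Theorems.FibreAnchor.Negative.DanglingLink

namespace Summit.QuantumFields.YangMills.Theorems.FibreAnchor.Negative.LoadBearingClauses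

/-! ## Load-bearing analysis — the three clauses, for every admissible `(G, r)` -/

section LoadBearing

variable {G : Type} [Group G] [TopologicalSpace G] [IsTopologicalGroup G] [CompactSpace G]
  [MeasurableSpace G] [BorelSpace G]

/-- **(A1) Load-bearing clause `2 * n < L` (time separations up to HALF the period).** With the
guard weakened to `n < L`, the clustering clause of the crux fails at `M = 0`, every `β`, every
rate `m₀ > 0`, every constant `C` and every volume floor — for EVERY compact group carrying a
faithful representation and an element `a ≠ 1`: the shift by `n = L − 1` wraps the time circle,
`F₂ ∘ σ_{L-1} = F₁` for the indicators `F₁ = 1{U((c,·),2) ∈ O}`, `F₂ = 1{U((c+1,·),2) ∈ O}` of a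
dangling direction-2 link, whose covariance is the Haar variance `P(1-P) ≥ 1/(2k)` uniformly in
`L`, while `C e^{-m₀ (L-1)} → 0`. ("Any proof must use `2n < L`", and it does: the trace
formula needs the long way round the circle to be longer than the short way.) -/
theorem clause_fullCircle_false (r : LatticeRep G) {a : G} (ha : a ≠ 1) (β m₀ C : ℝ)
    (hm₀ : 0 < m₀) (w Lmin : ℕ) (hw : 1 ≤ w) :
    ¬ (∀ (L : ℕ) [NeZero L], Lmin ≤ L → ∀ c : ZMod L, ∀ F₁ F₂ : Cfg G L 0 → ℝ,
        (Measurable F₁ ∧ (∀ U, |F₁ U| ≤ 1) ∧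
          ∀ U U', (∀ p : St L 0 × Fin 4, (p.1.1 - c).val ≤ w → U p = U' p) → F₁ U = F₁ U') →
        (Measurable F₂ ∧ (∀ U, |F₂ U| ≤ 1) ∧
          ∀ U U', (∀ p : St L 0 × Fin 4, (p.1.1 - c).val ≤ w → U p = U' p) → F₂ U = F₂ U') →
        ∀ n : ℕ, n < L →
          |Ex G r L 0 β (fun U => F₁ U * F₂ (shiftT G L 0 n U)) -
              Ex G r L 0 β F₁ * Ex G r L 0 β (fun U => F₂ (shiftT G L 0 n U))| ≤
            C * Real.exp (-(m₀ * n))) := by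
  intro hT
  obtain ⟨O, hO, k, hk, hvar⟩ := exists_variance_floor r ha
  obtain ⟨n₀, hn₀⟩ := exists_forall_lt_of_pos C m₀ (1 / (2 * k)) hm₀ (by positivity)
  -- the period
  obtain ⟨L, hLmin, hL2, hLn⟩ : ∃ L : ℕ, Lmin ≤ L ∧ 2 ≤ L ∧ n₀ ≤ L - 1 :=
    ⟨max (max Lmin 2) (n₀ + 1), le_trans (le_max_left _ _) (le_max_left _ _),
      le_trans (le_max_right _ _) (le_max_left _ _), by omega⟩
  haveI : NeZero L := ⟨by omega⟩
  -- indicators of the dangling links at times `0` and `1`, slab `[0, w]`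
  have hloc₀ := loc_obs (G := G) hO.measurableSet w (0 : ZMod L) 0 (Nat.zero_le w)
  have hloc₁ := loc_obs (G := G) hO.measurableSet w (0 : ZMod L) 1 hw
  have key := hT L hLmin (0 : ZMod L) _ _ hloc₀ hloc₁ (L - 1) (show L - 1 < L by omega)
  -- the full-circle shift brings time `1` back to time `0`
  have hcast : ((0 : ZMod L) + ((1 : ℕ) : ZMod L) + ((L - 1 : ℕ) : ZMod L)) = (0 : ZMod L) + ((0 : ℕ) : ZMod L) := by
    rw [Nat.cast_sub (by omega : 1 ≤ L), ZMod.natCast_self, Nat.cast_one, Nat.cast_zero]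
    ring
  simp only [obs_shiftT, hcast, obs_mul_self] at key
  have hv := hvar β L ((0 : ZMod L) + ((0 : ℕ) : ZMod L), 0, 0, 0)
  have hlt := hn₀ (L - 1) hLn
  exact absurd (lt_of_le_of_lt (le_trans (le_trans hv (le_abs_self _)) key) hlt) (lt_irrefl _)

/-- **(A2) Load-bearing order of quantifiers `∀ w ∃ C`.** If ONE constant `C` had to serve every
slab width `w` (the floor `Lmin` may still depend on `w`), the clause fails at `M = 0` for every
`(G, r)` as above, every `β`, `m₀ > 0`: take `n = w`, `F₁` the indicator of the dangling link at
time `c + w`, `F₂` the one at time `c`; then `F₂ ∘ σ_w = F₁` (overlapping slabs), covariance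
`≥ 1/(2k)`, against `C e^{-m₀ w} → 0` as `w → ∞`. (So `C = C(w)`, of size `e^{m₀ (w+1)}`, is
forced; the line's S2a constant `64·e^{m₀(w+1)}` has the right shape.) -/
theorem clause_uniformW_false (r : LatticeRep G) {a : G} (ha : a ≠ 1) (β m₀ C : ℝ)
    (hm₀ : 0 < m₀) (Lmin : ℕ → ℕ) :
    ¬ ∀ w : ℕ, (∀ (L : ℕ) [NeZero L], Lmin w ≤ L → ∀ c : ZMod L, ∀ F₁ F₂ : Cfg G L 0 → ℝ,
        (Measurable F₁ ∧ (∀ U, |F₁ U| ≤ 1) ∧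
          ∀ U U', (∀ p : St L 0 × Fin 4, (p.1.1 - c).val ≤ w → U p = U' p) → F₁ U = F₁ U') →
        (Measurable F₂ ∧ (∀ U, |F₂ U| ≤ 1) ∧
          ∀ U U', (∀ p : St L 0 × Fin 4, (p.1.1 - c).val ≤ w → U p = U' p) → F₂ U = F₂ U') →
        ∀ n : ℕ, 2 * n < L →
          |Ex G r L 0 β (fun U => F₁ U * F₂ (shiftT G L 0 n U)) -
              Ex G r L 0 β F₁ * Ex G r L 0 β (fun U => F₂ (shiftT G L 0 n U))| ≤
            C * Real.exp (-(m₀ * n))) := by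
  intro hT
  obtain ⟨O, hO, k, hk, hvar⟩ := exists_variance_floor r ha
  obtain ⟨n₀, hn₀⟩ := exists_forall_lt_of_pos C m₀ (1 / (2 * k)) hm₀ (by positivity)
  -- slab width `w = n₀`, separation `n = n₀`, period `L > 2 n₀`
  obtain ⟨L, hLmin, hL⟩ : ∃ L : ℕ, Lmin n₀ ≤ L ∧ 2 * n₀ < L :=
    ⟨max (Lmin n₀) (2 * n₀ + 1), le_max_left _ _, by omega⟩
  haveI : NeZero L := ⟨by omega⟩
  have hloc₀ := loc_obs (G := G) hO.measurableSet n₀ (0 : ZMod L) 0 (Nat.zero_le _)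
  have hloc₁ := loc_obs (G := G) hO.measurableSet n₀ (0 : ZMod L) n₀ le_rfl
  have key := hT n₀ L hLmin (0 : ZMod L) _ _ hloc₁ hloc₀ n₀ (show 2 * n₀ < L from hL)
  have hcast : ((0 : ZMod L) + ((0 : ℕ) : ZMod L) + (n₀ : ZMod L)) = (0 : ZMod L) + (n₀ : ZMod L) := by
    rw [Nat.cast_zero, add_zero]
  simp only [obs_shiftT, hcast, obs_mul_self] at key
  have hv := hvar β L ((0 : ZMod L) + (n₀ : ZMod L), 0, 0, 0)
  have hlt := hn₀ n₀ le_rfl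
  exact absurd (lt_of_le_of_lt (le_trans (le_trans hv (le_abs_self _)) key) hlt) (lt_irrefl _)

/-- **(A3) Load-bearing bound `|F U| ≤ 1`.** With unbounded observables (and a constant `C` not
depending on them) the clause fails at `M = 0` for every `(G, r)` as above, every `β`, `m₀`, `C`,
`Lmin`, already at separation `n = 1` and slab width `1`: scale the dangling-link indicators by
`s`; the covariance scales by `s²`. (Equivalently: `C` must be allowed to carry `‖F₁‖∞ ‖F₂‖∞`.) -/
theorem clauseU_false (r : LatticeRep G) {a : G} (ha : a ≠ 1) (β m₀ C : ℝ) (Lmin : ℕ) :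
    ¬ (∀ (L : ℕ) [NeZero L], Lmin ≤ L → ∀ c : ZMod L, ∀ F₁ F₂ : Cfg G L 0 → ℝ,
        (Measurable F₁ ∧
          ∀ U U', (∀ p : St L 0 × Fin 4, (p.1.1 - c).val ≤ 1 → U p = U' p) → F₁ U = F₁ U') →
        (Measurable F₂ ∧
          ∀ U U', (∀ p : St L 0 × Fin 4, (p.1.1 - c).val ≤ 1 → U p = U' p) → F₂ U = F₂ U') →
        ∀ n : ℕ, 2 * n < L →
          |Ex G r L 0 β (fun U => F₁ U * F₂ (shiftT G L 0 n U)) -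
              Ex G r L 0 β F₁ * Ex G r L 0 β (fun U => F₂ (shiftT G L 0 n U))| ≤
            C * Real.exp (-(m₀ * n))) := by
  intro hT
  obtain ⟨O, hO, k, hk, hvar⟩ := exists_variance_floor r ha
  obtain ⟨L, hLmin, hL⟩ : ∃ L : ℕ, Lmin ≤ L ∧ 3 ≤ L := ⟨max Lmin 3, le_max_left _ _, le_max_right _ _⟩
  haveI : NeZero L := ⟨by omega⟩
  -- the scale
  set v : ℝ := 1 / (2 * k) with hv_def
  have hv : 0 < v := by positivity
  set E : ℝ := Real.exp (-(m₀ * ((1 : ℕ) : ℝ))) with hE_def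
  have hE0 : 0 < E := Real.exp_pos _
  set B : ℝ := |C| * E + 1 with hB_def
  set s : ℝ := max 1 (B / v) with hs_def
  have hs1 : 1 ≤ s := le_max_left _ _
  have hs0 : 0 ≤ s := le_trans zero_le_one hs1
  have hsv : B ≤ s * s * v := by
    have h1 : B / v ≤ s := le_max_right _ _
    have h2 : B ≤ s * v := by rwa [div_le_iff₀ hv] at h1
    calc B ≤ s * v := h2
      _ = 1 * (s * v) := (one_mul _).symm
      _ ≤ s * (s * v) := mul_le_mul_of_nonneg_right hs1 (le_trans (by positivity) h2)
      _ = s * s * v := by ring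
  -- scaled indicators at times `0` and `1`
  obtain ⟨hm₀', -, hl₀⟩ := loc_obs (G := G) hO.measurableSet 1 (0 : ZMod L) 0 (Nat.zero_le _)
  obtain ⟨hm₁', -, hl₁⟩ := loc_obs (G := G) hO.measurableSet 1 (0 : ZMod L) 1 le_rfl
  set x₀ : St L 0 := ((0 : ZMod L) + ((0 : ℕ) : ZMod L), 0, 0, 0) with hx₀
  set x₁ : St L 0 := ((0 : ZMod L) + ((1 : ℕ) : ZMod L), 0, 0, 0) with hx₁
  have hlocU₀ : Measurable (fun U : Cfg G L 0 => s * obs O x₀ U) ∧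
      ∀ U U' : Cfg G L 0, (∀ p : St L 0 × Fin 4, (p.1.1 - (0 : ZMod L)).val ≤ 1 → U p = U' p) →
        s * obs O x₀ U = s * obs O x₀ U' :=
    ⟨measurable_const.mul hm₀', fun U U' h => by simp only [hl₀ U U' h]⟩
  have hlocU₁ : Measurable (fun U : Cfg G L 0 => s * obs O x₁ U) ∧
      ∀ U U' : Cfg G L 0, (∀ p : St L 0 × Fin 4, (p.1.1 - (0 : ZMod L)).val ≤ 1 → U p = U' p) →
        s * obs O x₁ U = s * obs O x₁ U' :=
    ⟨measurable_const.mul hm₁', fun U U' h => by simp only [hl₁ U U' h]⟩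
  have key := hT L hLmin (0 : ZMod L) _ _ hlocU₁ hlocU₀ 1 (show 2 * 1 < L by omega)
  have hshift : ∀ U : Cfg G L 0, obs O x₀ (shiftT G L 0 1 U) = obs O x₁ U := by
    intro U
    rw [hx₀, hx₁, obs_shiftT, Nat.cast_zero, add_zero]
  -- reduce the three expectations to `P = Ex(obs O x₁)`
  have e1 : (fun U : Cfg G L 0 => s * obs O x₁ U * (s * obs O x₀ (shiftT G L 0 1 U))) =
      fun U => (s * s) * obs O x₁ U := by
    funext U
    rw [hshift, mul_mul_mul_comm, obs_mul_self]
  have e2 : (fun U : Cfg G L 0 => s * obs O x₀ (shiftT G L 0 1 U)) = fun U => s * obs O x₁ U := by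
    funext U
    rw [hshift]
  rw [e1, e2, Ex_const_mul, Ex_const_mul] at key
  have hv' := hvar β L x₁
  set P := Ex G r L 0 β (obs O x₁)
  have hkey : s * s * (P - P * P) ≤ C * E := by
    have : s * s * P - s * P * (s * P) = s * s * (P - P * P) := by ring
    rw [this] at key
    exact le_trans (le_abs_self _) key
  have hC : C * E < B := by
    have : C * E ≤ |C| * E := mul_le_mul_of_nonneg_right (le_abs_self C) hE0.le
    rw [hB_def]
    linarith
  have hmid : s * s * v ≤ s * s * (P - P * P) := mul_le_mul_of_nonneg_left hv' (mul_nonneg hs0 hs0)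
  linarith

end LoadBearing

/-! ## Unconditional negations: `SU(2)` is a certified instance of the crux's hypotheses -/

section SU2

open Literature.MathematicalPhysics.QuantumLattice

/-- **`FibreAnchor` with the guard `2 * n < L` weakened to `n < L` is FALSE** (the statement
below is the crux VERBATIM with that one token changed). Any proof of the crux must use that the
long way round the time circle is longer than the short way. -/
theorem fibreAnchor_false_without_halfTimeGuard :
    ¬ (
      ∀ (G : Type) [Group G] [TopologicalSpace G] [IsTopologicalGroup G] [CompactSpace G], Literature.MathematicalPhysics.QuantumFieldTheory.IsCompactSimpleLieGroup G → letI : MeasurableSpace G := borel G; haveI : BorelSpace G := ⟨rfl⟩; ∀ r : Literature.MathematicalPhysics.QuantumFieldTheory.LatticeRep G, let Tube := fun (M : ℕ) (β m C : ℝ) (w Lmin : ℕ) => ∀ (L : ℕ) [NeZero L], Lmin ≤ L → let St := ZMod L × ZMod L × Fin (M + 1) × Fin (M + 1); let Cfg := St × Fin 4 → G; let ν : MeasureTheory.Measure Cfg := MeasureTheory.Measure.pi fun _ => Literature.MathematicalPhysics.QuantumFieldTheory.haarProbability G; let sh : St → Fin 4 → St := fun x μ => ![(x.1 + 1, x.2.1,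 x.2.2.1, x.2.2.2), (x.1, x.2.1 + 1, x.2.2.1, x.2.2.2), (x.1, x.2.1, x.2.2.1 + 1, x.2.2.2), (x.1, x.2.1, x.2.2.1, x.2.2.2 + 1)] μ; let ins : St → Fin 4 → Fin 4 → ℝ := fun x μ κ => if ((μ = 2 ∨ κ = 2) → (x.2.2.1 : ℕ) < M) ∧ ((μ = 3 ∨ κ = 3) → (x.2.2.2 : ℕ) < M) then 1 else 0; let pl : Cfg → St → Fin 4 → Fin 4 → G := fun U x μ κ => U (x, μ) * U (sh x μ, κ) * (U (sh x κ, μ))⁻¹ * (U (x, κ))⁻¹; let act : Cfg → ℝ := fun U => β * ∑ x : St, ∑ q : {q : Fin 4 × Fin 4 // q.1 < q.2}, ins x q.1.1 q.1.2 * (r.ρ (pl U x q.1.1 q.1.2)).trace.re; let wgt : Cfg → ℝ := fun U => Real.exp (act U); let Ex : (Cfg → ℝ) → ℝ := fun F => (∫ U, F U * wgt U ∂ν) / (∫ U, wgt U ∂ν); let σ : ℕ → Cfg → Cfg := fun n U p => U ((p.1.1 + n, p.1.2), p.2); ∀ c : ZMod L, let Loc := fun F : Cfg → ℝ => Measurable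 F ∧ (∀ U, |F U| ≤ 1) ∧ ∀ U U', (∀ p : St × Fin 4, (p.1.1 - c).val ≤ w → U p = U' p) → F U = F U'; ∀ F₁ F₂ : Cfg → ℝ, Loc F₁ → Loc F₂ → ∀ n : ℕ, n < L → |Ex (fun U => F₁ U * F₂ (σ n U)) - Ex F₁ * Ex (fun U => F₂ (σ n U))| ≤ C * Real.exp (-(m * n)); ∀ M : ℕ, ∃ β₀ m₀ : ℝ, 0 < m₀ ∧ ∀ β : ℝ, β₀ ≤ β → ∀ w : ℕ, ∃ C : ℝ, ∃ Lmin : ℕ, Tube M β m₀ C w Lmin) := by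
  intro h
  have hSU : IsCompactSimpleLieGroup (Matrix.specialUnitaryGroup (Fin 2) ℂ) :=
    isCompactSimpleLieGroup_specialUnitaryGroup isSimpleCompactGroup_specialUnitaryGroup_holds
      le_rfl
  let r₂ : LatticeRep (Matrix.specialUnitaryGroup (Fin 2) ℂ) :=
    ⟨2, fundamentalRep (Fin 2), continuous_fundamentalRep _, fundamentalRep_injective _,
      fundamentalRep_mem_unitaryGroup⟩
  obtain ⟨β₀, m₀, hm₀, h2⟩ := h (Matrix.specialUnitaryGroup (Fin 2) ℂ) hSU r₂ 0
  obtain ⟨C, Lmin, hT⟩ := h2 β₀ le_rfl 1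
  obtain ⟨-, ⟨a, b, hab⟩, -⟩ := hSU.1
  have ha : a ≠ 1 := fun ha => hab (by rw [ha, one_mul, mul_one])
  exact clause_fullCircle_false r₂ ha β₀ m₀ C hm₀ 1 Lmin le_rfl hT

/-- **`FibreAnchor` with ONE constant for all slab widths (`∃ C, ∀ w, ∃ Lmin` in place of
`∀ w, ∃ C, ∃ Lmin`) is FALSE** (crux verbatim otherwise): `C = C(w)`, of size `e^{m₀ (w+1)}`, is
forced by overlapping slabs. -/
theorem fibreAnchor_false_with_widthUniformConstant :
    ¬ (
      ∀ (G : Type) [Group G] [TopologicalSpace G] [IsTopologicalGroup G] [CompactSpace G], Literature.MathematicalPhysics.QuantumFieldTheory.IsCompactSimpleLieGroup G → letI : MeasurableSpace G := borel G; haveI : BorelSpace G := ⟨rfl⟩; ∀ r : Literature.MathematicalPhysics.QuantumFieldTheory.LatticeRep G, let Tube := fun (M : ℕ) (β m C : ℝ) (w Lmin : ℕ) => ∀ (L : ℕ) [NeZero L], Lmin ≤ L → let St := ZMod L × ZMod L × Fin (M + 1) × Fin (M + 1); let Cfg := St × Fin 4 → G; let ν : MeasureTheory.Measure Cfg := MeasureTheory.Measure.pi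 fun _ => Literature.MathematicalPhysics.QuantumFieldTheory.haarProbability G; let sh : St → Fin 4 → St := fun x μ => ![(x.1 + 1, x.2.1, x.2.2.1, x.2.2.2), (x.1, x.2.1 + 1, x.2.2.1, x.2.2.2), (x.1, x.2.1, x.2.2.1 + 1, x.2.2.2), (x.1, x.2.1, x.2.2.1, x.2.2.2 + 1)] μ; let ins : St → Fin 4 → Fin 4 → ℝ := fun x μ κ => if ((μ = 2 ∨ κ = 2) → (x.2.2.1 : ℕ) < M) ∧ ((μ = 3 ∨ κ = 3) → (x.2.2.2 : ℕ) < M) then 1 else 0; let pl : Cfg → St → Fin 4 → Fin 4 → G := fun U x μ κ => U (x, μ) * U (sh x μ, κ) * (U (sh x κ, μ))⁻¹ * (U (x, κ))⁻¹; let act : Cfg → ℝ := fun U => β * ∑ x : St, ∑ q : {q : Fin 4 × Fin 4 // q.1 < q.2}, ins x q.1.1 q.1.2 * (r.ρ (pl U x q.1.1 q.1.2)).trace.re; let wgt : Cfg → ℝ := fun U => Real.exp (act U); let Ex : (Cfg → ℝ) → ℝ := fun F => (∫ U, F U * wgt U ∂ν) / (∫ U, wgt U ∂ν); let σ : ℕ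 → Cfg → Cfg := fun n U p => U ((p.1.1 + n, p.1.2), p.2); ∀ c : ZMod L, let Loc := fun F : Cfg → ℝ => Measurable F ∧ (∀ U, |F U| ≤ 1) ∧ ∀ U U', (∀ p : St × Fin 4, (p.1.1 - c).val ≤ w → U p = U' p) → F U = F U'; ∀ F₁ F₂ : Cfg → ℝ, Loc F₁ → Loc F₂ → ∀ n : ℕ, 2 * n < L → |Ex (fun U => F₁ U * F₂ (σ n U)) - Ex F₁ * Ex (fun U => F₂ (σ n U))| ≤ C * Real.exp (-(m * n)); ∀ M : ℕ, ∃ β₀ m₀ : ℝ, 0 < m₀ ∧ ∀ β : ℝ, β₀ ≤ β → ∃ C : ℝ, ∀ w : ℕ, ∃ Lmin : ℕ, Tube M β m₀ C w Lmin) := by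
  intro h
  have hSU : IsCompactSimpleLieGroup (Matrix.specialUnitaryGroup (Fin 2) ℂ) :=
    isCompactSimpleLieGroup_specialUnitaryGroup isSimpleCompactGroup_specialUnitaryGroup_holds
      le_rfl
  let r₂ : LatticeRep (Matrix.specialUnitaryGroup (Fin 2) ℂ) :=
    ⟨2, fundamentalRep (Fin 2), continuous_fundamentalRep _, fundamentalRep_injective _,
      fundamentalRep_mem_unitaryGroup⟩
  obtain ⟨β₀, m₀, hm₀, h2⟩ := h (Matrix.specialUnitaryGroup (Fin 2) ℂ) hSU r₂ 0
  obtain ⟨C, hC⟩ := h2 β₀ le_rfl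
  choose Lmin hLmin using hC
  obtain ⟨-, ⟨a, b, hab⟩, -⟩ := hSU.1
  have ha : a ≠ 1 := fun ha => hab (by rw [ha, one_mul, mul_one])
  exact clause_uniformW_false r₂ ha β₀ m₀ C hm₀ Lmin hLmin

/-- **`FibreAnchor` without the bound `∀ U, |F U| ≤ 1` on the observables is FALSE** (crux
verbatim otherwise): the constant `C` must be allowed to carry `‖F₁‖∞ ‖F₂‖∞`. -/
theorem fibreAnchor_false_without_observableBound :
    ¬ (
      ∀ (G : Type) [Group G] [TopologicalSpace G] [IsTopologicalGroup G] [CompactSpace G], Literature.MathematicalPhysics.QuantumFieldTheory.IsCompactSimpleLieGroup G → letI : MeasurableSpace G := borel G; haveI : BorelSpace G := ⟨rfl⟩; ∀ r : Literature.MathematicalPhysics.QuantumFieldTheory.LatticeRep G, let Tube := fun (M : ℕ) (β m C : ℝ) (w Lmin : ℕ) => ∀ (L : ℕ) [NeZero L], Lmin ≤ L → let St := ZMod L × ZMod L × Fin (M + 1) × Fin (M + 1); let Cfg := St × Fin 4 → G; let ν : MeasureTheory.Measure Cfg := MeasureTheory.Measure.pi fun _ => Literature.MathematicalPhysics.QuantumFieldTheory.haarProbability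 G; let sh : St → Fin 4 → St := fun x μ => ![(x.1 + 1, x.2.1, x.2.2.1, x.2.2.2), (x.1, x.2.1 + 1, x.2.2.1, x.2.2.2), (x.1, x.2.1, x.2.2.1 + 1, x.2.2.2), (x.1, x.2.1, x.2.2.1, x.2.2.2 + 1)] μ; let ins : St → Fin 4 → Fin 4 → ℝ := fun x μ κ => if ((μ = 2 ∨ κ = 2) → (x.2.2.1 : ℕ) < M) ∧ ((μ = 3 ∨ κ = 3) → (x.2.2.2 : ℕ) < M) then 1 else 0; let pl : Cfg → St → Fin 4 → Fin 4 → G := fun U x μ κ => U (x, μ) * U (sh x μ, κ) * (U (sh x κ, μ))⁻¹ * (U (x, κ))⁻¹; let act : Cfg → ℝ := fun U => β * ∑ x : St, ∑ q : {q : Fin 4 × Fin 4 // q.1 < q.2}, ins x q.1.1 q.1.2 * (r.ρ (pl U x q.1.1 q.1.2)).trace.re; let wgt : Cfg → ℝ := fun U => Real.exp (act U); let Ex : (Cfg → ℝ) → ℝ := fun F => (∫ U, F U * wgt U ∂ν) / (∫ U, wgt U ∂ν); let σ : ℕ → Cfg → Cfg := fun n U p => U ((p.1.1 + n, p.1.2),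 p.2); ∀ c : ZMod L, let Loc := fun F : Cfg → ℝ => Measurable F ∧ ∀ U U', (∀ p : St × Fin 4, (p.1.1 - c).val ≤ w → U p = U' p) → F U = F U'; ∀ F₁ F₂ : Cfg → ℝ, Loc F₁ → Loc F₂ → ∀ n : ℕ, 2 * n < L → |Ex (fun U => F₁ U * F₂ (σ n U)) - Ex F₁ * Ex (fun U => F₂ (σ n U))| ≤ C * Real.exp (-(m * n)); ∀ M : ℕ, ∃ β₀ m₀ : ℝ, 0 < m₀ ∧ ∀ β : ℝ, β₀ ≤ β → ∀ w : ℕ, ∃ C : ℝ, ∃ Lmin : ℕ, Tube M β m₀ C w Lmin) := by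
  intro h
  have hSU : IsCompactSimpleLieGroup (Matrix.specialUnitaryGroup (Fin 2) ℂ) :=
    isCompactSimpleLieGroup_specialUnitaryGroup isSimpleCompactGroup_specialUnitaryGroup_holds
      le_rfl
  let r₂ : LatticeRep (Matrix.specialUnitaryGroup (Fin 2) ℂ) :=
    ⟨2, fundamentalRep (Fin 2), continuous_fundamentalRep _, fundamentalRep_injective _,
      fundamentalRep_mem_unitaryGroup⟩
  obtain ⟨β₀, m₀, -, h2⟩ := h (Matrix.specialUnitaryGroup (Fin 2) ℂ) hSU r₂ 0
  obtain ⟨C, Lmin, hT⟩ := h2 β₀ le_rfl 1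
  obtain ⟨-, ⟨a, b, hab⟩, -⟩ := hSU.1
  have ha : a ≠ 1 := fun ha => hab (by rw [ha, one_mul, mul_one])
  exact clauseU_false r₂ ha β₀ m₀ C Lmin hT

end SU2

end Summit.QuantumFields.YangMills.Theorems.FibreAnchor.Negative.LoadBearingClauses

end
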